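import Mathlib

/-!
# TropicalLinks / InductiveStep — homogeneous representatives of every large degree

Route `ResolutionOfSingularities/TropicalLinks`, crux `InductiveStep` (stmt-ResolutionOfSingularities-17233),
line `split`, brick GG, in support of the geometric producer `stub_valuativeCharts`.

For a field `k`, a commutative `k`-algebra `K` and elements `y₀, …, yₙ ∈ K` with `y_h = 1` (the
coordinates `y_j = X_j / X_h` of the `h`-th affine chart of a projective variety in `ℙⁿ`), the chart
ring is `𝒞_h = k[y₀, …, yₙ] = Algebra.adjoin k (Set.range y) ⊆ K`, and a homogeneous form `F` of
degree `d` restricts to the chart as `F(y) = F / X_h ^ d`.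

* `tropicalLinks_exists_isHomogeneous_aeval_eq` — **every element `c ∈ 𝒞_h` is the restriction of a
  homogeneous form of every large degree.**  Proof: `𝒞_h` is the range of `MvPolynomial.aeval y`
  (`Algebra.adjoin_range_eq_range_aeval`), so `c = p(y)` for a polynomial `p`; for `d ≥ deg p`
  homogenise `p` by powers of `X_h`, `F := ∑_{i ≤ deg p} X_h ^ (d - i) · p_i` with `p_i` the
  homogeneous component of degree `i`; `F` is homogeneous of degree `d`, and since `y_h = 1` its value
  at `y` is `∑ p_i(y) = p(y) = c` (`MvPolynomial.sum_homogeneousComponent`).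

This is the "bounded degree of generators" input (`I_D(d)` generated by forms for `d ≥ d₀`) that the
line uses chart by chart in `stub_valuativeCharts`; no cohomology is involved.
-/

-- single-problem summit: the doubled namespace component `ResolutionOfSingularities` is forced
set_option linter.dupNamespace false

namespace Summit.ResolutionOfSingularities.ResolutionOfSingularities.Theorems

/-- **Homogeneous representatives of every large degree.** For a field `k`, a commutative
`k`-algebra `K`, elements `y : Fin (n + 1) → K` with `y h = 1` and any `c` in the chart ring
`k[y₀, …, yₙ] = Algebra.adjoin k (Set.range y)`, there is a `d₀` such that for every `d ≥ d₀` some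
homogeneous `F ∈ k[X₀, …, Xₙ]` of degree exactly `d` evaluates to `c` at `y`: write `c = p(y)`,
take `d₀ = deg p` and `F = ∑_{i ≤ d₀} X_h ^ (d - i) · (homogeneous component of degree i of p)`;
as `y_h = 1`, `F(y) = ∑ p_i(y) = p(y) = c`. [folklore] -/
theorem tropicalLinks_exists_isHomogeneous_aeval_eq :
    ∀ (k : Type) [Field k] (K : Type) [CommRing K] [Algebra k K] (n : ℕ) (y : Fin (n + 1) → K) (h : Fin (n + 1)), y h = 1 → ∀ c ∈ Algebra.adjoin k (Set.range y), ∃ d₀ : ℕ, ∀ d ≥ d₀, ∃ F : MvPolynomial (Fin (n + 1)) k, F.IsHomogeneous d ∧ MvPolynomial.aeval y F = c := by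
  intro k _ K _ _ n y h hy c hc
  -- `c = p(y)` for a polynomial `p`
  rw [Algebra.adjoin_range_eq_range_aeval, AlgHom.mem_range] at hc
  obtain ⟨p, rfl⟩ := hc
  refine ⟨p.totalDegree, fun d hd => ?_⟩
  -- homogenise `p` by powers of `X_h` to a form of degree `d ≥ deg p`
  refine ⟨∑ i ∈ Finset.range (p.totalDegree + 1),
    MvPolynomial.X h ^ (d - i) * MvPolynomial.homogeneousComponent i p, ?_, ?_⟩
  · refine MvPolynomial.IsHomogeneous.sum _ _ _ fun i hi => ?_
    have hid : d - i + i = d :=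
      Nat.sub_add_cancel ((Nat.lt_succ_iff.mp (Finset.mem_range.mp hi)).trans hd)
    have := (MvPolynomial.isHomogeneous_X_pow h (d - i)).mul
      (MvPolynomial.homogeneousComponent_isHomogeneous i p)
    rwa [hid] at this
  · -- since `y_h = 1`, `F(y) = ∑ p_i(y) = p(y)`
    rw [map_sum]
    have hterm : ∀ i ∈ Finset.range (p.totalDegree + 1), MvPolynomial.aeval y
        (MvPolynomial.X h ^ (d - i) * MvPolynomial.homogeneousComponent i p) =
        MvPolynomial.aeval y (MvPolynomial.homogeneousComponent i p) := by
      intro i _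
      rw [map_mul, map_pow, MvPolynomial.aeval_X, hy, one_pow, one_mul]
    rw [Finset.sum_congr rfl hterm, ← map_sum, MvPolynomial.sum_homogeneousComponent]

end Summit.ResolutionOfSingularities.ResolutionOfSingularities.Theorems
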